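import Summits.BirchSwinnertonDyer.BirchSwinnertonDyer.Theorems.TwoAdicConverseIsoT1Transport
import Summits.BirchSwinnertonDyer.BirchSwinnertonDyer.Theorems.TwoAdicConverseEulerCharKernelAtTwoIsogeny
import Summits.BirchSwinnertonDyer.Rank1Residual.X2.IsogenyQuotientLine
import Literature.NumberTheory.EllipticCurves.RationalIsogenyDegrees
import Literature.NumberTheory.EllipticCurves.IsogenyDualElliptic
import Literature.NumberTheory.EllipticCurves.CMTorsionIrreducibleOrdinaryProofs
import HarnessLib

set_option linter.dupNamespace false -- `…BirchSwinnertonDyer.BirchSwinnertonDyer…` is the cell's nested layout (D-0017)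
set_option autoImplicit false

/-!
# (ISO-T₁) road K, part 2: consecutive failures of (T₁)@2 along `E/(C_v ∩ E[2^k])` give rational CYCLIC `2ⁿ`-isogenies;
# Mazur–Kenku + `End(E) = ℤ` stop the chain at `n ≤ 4` — (ISO-T₁)∣(β) and item 19218 modulo PRINT {modularity, Kato 17.4@2, Mazur–Kenku}
# and the crux `OrdLambdaHalfAtTwo`

Cell `bsd-2adic` (run/shared/lean/pub/bsd-2adic/), seat `bsd-2adic-tower-1` GEN 37 (SUMMON RC-513/RC-515 «`IsoT1AtTwo` + `isoT1AtTwo_of_not_hasCM`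
via road K», director-bsd g20).  THEOREMS ONLY (no definition, no named fact, no instance, no `sorry`); `--supports stmt-BirchSwinnertonDyer-19218`
(route `TwoAdicConverse`, rung S3).  HONEST FRAMING: item 19218 stays OPEN (its crux `OrdLambdaHalfAtTwo`, item 19556, is open); the inputs
modularity, Kato 17.4 (1)(2)@2 and Mazur–Kenku are PRINTED named facts taken as hypotheses; nothing is booked; BSD is not proved by any of this.

THE ARGUMENT (road K of the summon; Greenberg LNM 1716 §5 p. 123 «the `ℚ`-isogeny class … `C₂[2]`»; tower-1 GEN 36 census: the
`Γ₀(N)`-optimal member of each of the 169 classes satisfies (T₁)@2).  `E/ℚ` globally minimal, good ordinary at `2`, `v ∣ 2`,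
`C_v(E) = ker(E[2^∞] → Ẽ) ≅ ℚ₂/ℤ₂` (X2's `reductionDatum`).  (T₁)@2 FAILS at a minimal `E'` iff a non-zero rational `2`-power torsion
point of `E'` reduces into `E'₁`, i.e. (part 1, §4) iff `C_v(E') ∩ E'[2] = {0, q}` with `q` RATIONAL.  Suppose every minimal curve
`ℚ`-isogenous to `E` fails.  §7: if `C_v(E) ∩ E[2^k]` is `Γ_ℚ`-stable then, with `ψ : E → E' =` (minimal model of) `E/(C_v ∩ E[2^k])`
(`exists_isogeny_ker_eq_and_comp_eq_nsmul_holds` = Silverman III.4.12 in the tree, `hasGlobalMinimalModel_rat_holds`), the transport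
`ψ(C_v(E)) = C_v(E')` of part 1 gives `C_v(E) ∩ E[2^{k+1}] = ψ⁻¹{0, q}`, `Γ_ℚ`-stable.  §8: so `C_v(E) ∩ E[32]` is a rational CYCLIC subgroup
of order `32` and `g₅ : E → E₅ = E/(C_v ∩ E[32])` a rational cyclic `32`-isogeny; Mazur–Kenku supplies a cyclic `φ : E → E₅` of degree
`d ∈ {1..19, 21, 25, 27, 37, 43, 67, 163}`, `φ̂ ∘ g₅ ∈ End_ℚ(E) = ℤ` (`¬ HasCM`) is `[n]` with `32 ∣ n` and `n² = 32 d` — so `32 ∣ d`, absurd.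

* §5 `exists_layer_eq_zmultiples`, `finite_layer_and_natCard` — `C_v ∩ E[2^k] = ℤ g_k`, finite of order `2^k` in `E(ℚ̄)`.
* §6 `natCard_comap_eq_of_surjective` — `#f⁻¹K = #ker f · #K`.
* §7 ★ `smul_mem_plus_succ_of_fails`, `smul_mem_plus_of_fails` — the step and the induction.
* §8 ★★ `exists_isIsogenous_T1_of_mazurKenku` — (ISO-T₁) per curve (the `hISO` of p749231) from `mazurKenku_exists_cyclic_isogeny`;
  ★★ `goodOrdinaryRankZeroTwoConverse_of_ordLambdaHalfAtTwo_of_mazurKenku (hmod) (h17) (hΛ) (hMK)` — the ROUTE DECL of item 19218.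

References: [SilvermanAEC2009] III.4.12, III.6.1–6.2, VII.2.1–2.2, VIII.8.3, IX.6 Example 6.4; [Mazur1978] Thm. 1; [Kenku1982];
[GreenbergLNM1716] §2 pp. 62–63, 69–70, Thm. 4.1 (p. 102), §5 p. 123; [Kato2004Asterisque] Thm. 17.4.
-/

noncomputable section

open scoped Classical NumberField

open NumberField IsDedekindDomain Field WeierstrassCurve
  Literature.NumberTheory.EllipticCurves Literature.NumberTheory.EllipticCurves.GreenbergSelmer
  Literature.NumberTheory.GaloisRepresentations IsDedekindDomain.HeightOneSpectrum
  Summit.BirchSwinnertonDyer.Rank1Residual.X2.GreenbergVatsalReductionDatum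
  Summit.BirchSwinnertonDyer.Rank1Residual.Additive
  Summit.BirchSwinnertonDyer.BirchSwinnertonDyer.Theorems.SchneiderFree

namespace Summit.BirchSwinnertonDyer.BirchSwinnertonDyer.Theorems.TwoAdicEulerCharKernel.IsoT1

/-! ## §5 The layers `C_v ∩ E[2^k]` -/

section Layer

variable (W : WeierstrassCurve ℚ) [W.IsGloballyMinimal] [W.IsElliptic] {v : HeightOneSpectrum (𝓞 ℚ)}
  (hv : ((2 : ℕ) : 𝓞 ℚ) ∈ v.asIdeal) (hΔ : ¬ (2 : ℤ) ∣ minimalDiscriminantInt W) (hord : ¬ (2 : ℤ) ∣ W.frobeniusTrace 2)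

include hord in
/-- **`C_v ∩ E[2^k] = ℤ g_k`** for a generator `g_k ∈ C_v` of order `2^k` (cyclic layer of order `2^k`).
[cite: GreenbergLNM1716, §1 p. 62 (ℱ[p^∞] ≅ ℚ_p/ℤ_p)] -/
theorem exists_layer_eq_zmultiples (k : ℕ) :
    ∃ g : W.geomPrimaryTorsion 2, g ∈ (reductionDatum W 2 hv hΔ).plus ∧ addOrderOf g = 2 ^ k ∧
      (reductionDatum W 2 hv hΔ).plus ⊓ AddSubgroup.torsionBy (W.geomPrimaryTorsion 2) ((2 ^ k : ℕ) : ℤ) =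
        AddSubgroup.zmultiples g := by
  obtain ⟨g, hgC, hgord, hgen⟩ := exists_generator_plus W hv hΔ hord k
  refine ⟨g, hgC, hgord, le_antisymm ?_ ?_⟩
  · rintro m ⟨hmC, hmk⟩
    obtain ⟨j, rfl⟩ := hgen m hmC (AddSubgroup.torsionBy.nsmul_iff.mp hmk)
    exact ⟨j, natCast_zsmul g j⟩
  · rw [AddSubgroup.zmultiples_le]
    refine ⟨hgC, AddSubgroup.torsionBy.nsmul_iff.mpr ?_⟩
    rw [← hgord]; exact addOrderOf_nsmul_eq_zero g

include hord in
/-- The layer `C_v ∩ E[2^k]`, pushed into `E(ℚ̄)`, is finite of order `2^k`. [cite: GreenbergLNM1716, §1 p. 62] -/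
theorem finite_layer_and_natCard (k : ℕ) :
    ((((reductionDatum W 2 hv hΔ).plus ⊓ AddSubgroup.torsionBy (W.geomPrimaryTorsion 2) ((2 ^ k : ℕ) : ℤ)).map
        (W.geomPrimaryTorsion 2).subtype : AddSubgroup W.geomPoints) : Set W.geomPoints).Finite ∧
      Nat.card (((reductionDatum W 2 hv hΔ).plus ⊓ AddSubgroup.torsionBy (W.geomPrimaryTorsion 2) ((2 ^ k : ℕ) : ℤ)).map
        (W.geomPrimaryTorsion 2).subtype) = 2 ^ k := by
  obtain ⟨g, -, hgord, hlayer⟩ := exists_layer_eq_zmultiples W hv hΔ hord k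
  have hcard : Nat.card (((reductionDatum W 2 hv hΔ).plus ⊓ AddSubgroup.torsionBy (W.geomPrimaryTorsion 2)
      ((2 ^ k : ℕ) : ℤ)).map (W.geomPrimaryTorsion 2).subtype) = 2 ^ k := by
    rw [hlayer, AddMonoidHom.map_zmultiples, Nat.card_zmultiples, AddSubgroup.coe_subtype, ← hgord]
    exact addOrderOf_injective (W.geomPrimaryTorsion 2).subtype Subtype.coe_injective g
  refine ⟨?_, hcard⟩
  have : Finite (((reductionDatum W 2 hv hΔ).plus ⊓ AddSubgroup.torsionBy (W.geomPrimaryTorsion 2)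
      ((2 ^ k : ℕ) : ℤ)).map (W.geomPrimaryTorsion 2).subtype) :=
    Nat.finite_of_card_ne_zero (by rw [hcard]; exact pow_ne_zero _ two_ne_zero)
  exact Set.toFinite _

end Layer

/-! ## §6 Kernel counting along a surjection -/

section Count

/-- `#f⁻¹(K) = #ker f · #K` for a surjective homomorphism `f` (Lagrange for `ker f ≤ f⁻¹(K)` and `f⁻¹(K)/ker f ≅ K`). [folklore] -/
theorem natCard_comap_eq_of_surjective {A B : Type*} [AddCommGroup A] [AddCommGroup B] (f : A →+ B)
    (hf : Function.Surjective f) (K : AddSubgroup B) : Nat.card (K.comap f) = Nat.card f.ker * Nat.card K := by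
  set f' : K.comap f →+ K := f.addSubgroupComap K with hf'
  have hsurj : Function.Surjective f' := by
    rintro ⟨b, hb⟩
    obtain ⟨a, rfl⟩ := hf b
    exact ⟨⟨a, hb⟩, rfl⟩
  have e1 : Nat.card (K.comap f ⧸ f'.ker) = Nat.card K := Nat.card_congr (QuotientAddGroup.quotientKerEquivOfSurjective f' hsurj).toEquiv
  have e2 : Nat.card f'.ker = Nat.card f.ker := by
    refine Nat.card_congr ⟨fun x ↦ ⟨(x.1 : A), ?_⟩, fun y ↦ ⟨⟨y.1, ?_⟩, ?_⟩, fun x ↦ rfl, fun y ↦ rfl⟩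
    · have h := x.2
      rw [AddMonoidHom.mem_ker] at h ⊢
      exact congrArg Subtype.val h
    · rw [AddSubgroup.mem_comap, (AddMonoidHom.mem_ker).mp y.2]; exact K.zero_mem
    · rw [AddMonoidHom.mem_ker]; exact Subtype.ext ((AddMonoidHom.mem_ker).mp y.2)
  rw [AddSubgroup.card_eq_card_quotient_mul_card_addSubgroup f'.ker, e1, e2, mul_comm]

end Count

/-! ## §7 One step of the chain: `C_v ∩ E[2^k]` rational ⟹ `C_v ∩ E[2^{k+1}]` rational, if (T₁)@2 fails at `E/(C_v ∩ E[2^k])` -/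

section Step

variable {W : WeierstrassCurve ℚ} [W.IsGloballyMinimal] [W.IsElliptic] {v : HeightOneSpectrum (𝓞 ℚ)}
  (hv : ((2 : ℕ) : 𝓞 ℚ) ∈ v.asIdeal) (hgo : Rank1Residual.GoodOrd W 2)

include hgo in
/-- ★ **THE STEP OF ROAD K.**  `E/ℚ` globally minimal, good ordinary at `2`; suppose (T₁)@2 FAILS at EVERY globally minimal curve
`ℚ`-isogenous to `E` (some non-zero rational `2`-power torsion point maps into the kernel of reduction at `v ∣ 2`).  If the layer
`C_v(E) ∩ E[2^k]` is `Γ_ℚ`-stable, so is `C_v(E) ∩ E[2^{k+1}]`.  Proof: `S = C_v ∩ E[2^k]` is finite `Γ_ℚ`-stable, so `E → E₁ = E/S`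
exists over `ℚ` (`exists_isogeny_ker_eq_and_comp_eq_nsmul_holds`, Silverman III.4.12), and `E' = ` a global minimal model of `E₁`
(`hasGlobalMinimalModel_rat_holds`); `ψ : E → E'` has kernel `S ⊆ C_v(E)`.  The failing rational point of `E'` gives a `Γ_ℚ`-FIXED
`q ∈ C_v(E')` of order `2` (§4), so `C_v(E') ∩ E'[2] = {0, q}` is pointwise fixed.  For `m ∈ C_v(E) ∩ E[2^{k+1}]`: `ψ m ∈ C_v(E')`
(§3 transport) with `2ψ m = ψ(2m) = 0` (`2m ∈ S`), so `σ ψ m = ψ m`, i.e. `ψ(σ m) ∈ C_v(E')`, whence `σ m ∈ C_v(E)` (§3 pull-back).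
[cite: SilvermanAEC2009, Prop. III.4.12, Rem. III.4.13.2, VIII.8.3] [cite: GreenbergLNM1716, §2 pp. 63, 69–70] -/
theorem smul_mem_plus_succ_of_fails
    (hfail : ∀ (W' : WeierstrassCurve ℚ) [W'.IsElliptic] [W'.IsGloballyMinimal], IsIsogenous W W' →
      ∃ P : W'.toAffine.Point, P ≠ 0 ∧ (∃ t : ℕ, 2 ^ t • toGeomPoints W' P = 0) ∧
        pointsMap W' (v.adicCompletion ℚ) (toGeomPoints W' P) ∈ W'.localKernelOfReduction v)
    (k : ℕ)
    (hstab : ∀ (σ : absoluteGaloisGroup ℚ) (m : W.geomPrimaryTorsion 2),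
      m ∈ (reductionDatum W 2 hv (W.not_dvd_minimalDiscriminantInt_of_hasGoodReductionAtPrime' 2 hgo.1)).plus →
        2 ^ k • m = 0 → σ • m ∈ (reductionDatum W 2 hv (W.not_dvd_minimalDiscriminantInt_of_hasGoodReductionAtPrime' 2 hgo.1)).plus)
    (σ : absoluteGaloisGroup ℚ) (m : W.geomPrimaryTorsion 2)
    (hmC : m ∈ (reductionDatum W 2 hv (W.not_dvd_minimalDiscriminantInt_of_hasGoodReductionAtPrime' 2 hgo.1)).plus)
    (hm : 2 ^ (k + 1) • m = 0) :
    σ • m ∈ (reductionDatum W 2 hv (W.not_dvd_minimalDiscriminantInt_of_hasGoodReductionAtPrime' 2 hgo.1)).plus := by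
  set hΔ := W.not_dvd_minimalDiscriminantInt_of_hasGoodReductionAtPrime' 2 hgo.1 with hΔdef
  have hord : ¬ (2 : ℤ) ∣ W.frobeniusTrace 2 := hgo.2
  -- the layer `S = C_v ∩ E[2^k]` in `E(ℚ̄)`: finite and `Γ_ℚ`-stable
  set S : AddSubgroup W.geomPoints := ((reductionDatum W 2 hv hΔ).plus ⊓
    AddSubgroup.torsionBy (W.geomPrimaryTorsion 2) ((2 ^ k : ℕ) : ℤ)).map (W.geomPrimaryTorsion 2).subtype with hS
  have hSfin : (S : Set W.geomPoints).Finite := (finite_layer_and_natCard W hv hΔ hord k).1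
  have hSstab : ∀ (τ : absoluteGaloisGroup ℚ) (P : W.geomPoints), P ∈ S → τ • P ∈ S := by
    rintro τ _ ⟨c, ⟨hcC, hck⟩, rfl⟩
    refine ⟨τ • c, ⟨hstab τ c hcC (AddSubgroup.torsionBy.nsmul_iff.mp hck), AddSubgroup.torsionBy.nsmul_iff.mpr ?_⟩,
      (primaryComponent.coe_smul 2 τ c).symm⟩
    rw [smul_comm, AddSubgroup.torsionBy.nsmul_iff.mp hck, smul_zero]
  -- the quotient `E → E/S` and a global minimal model `E'` of it
  obtain ⟨W₁, hW₁, g, -, hker, -, -⟩ := W.exists_isogeny_ker_eq_and_comp_eq_nsmul_holds S hSfin hSstab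
  obtain ⟨C₁, hC₁⟩ := hasGlobalMinimalModel_rat_holds W₁
  set ψ : Isogeny W (C₁ • W₁) := (VariableChange.toIsogeny W₁ C₁).comp g with hψ
  have hkerψ : ψ.toAddMonoidHom.ker = S := by
    rw [hψ, Isogeny.ker_comp, VariableChange.ker_toIsogeny, AddMonoidHom.comap_bot, hker]
  have hiso : IsIsogenous W (C₁ • W₁) := ⟨ψ⟩
  have hgo' : Rank1Residual.GoodOrd (C₁ • W₁) 2 := goodOrd_of_isIsogenous hiso hgo
  set hΔ' := (C₁ • W₁).not_dvd_minimalDiscriminantInt_of_hasGoodReductionAtPrime' 2 hgo'.1 with hΔ'def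
  have hord' : ¬ (2 : ℤ) ∣ (C₁ • W₁).frobeniusTrace 2 := hgo'.2
  -- `ker ψ ∩ E[2^∞] ⊆ C_v(E)`
  have hkerC : ∀ c : W.geomPrimaryTorsion 2, isogenyPrimaryMap (p := 2) ψ c = 0 → c ∈ (reductionDatum W 2 hv hΔ).plus := by
    intro c hc
    have hcS : (c : W.geomPoints) ∈ S := by
      rw [← hkerψ, AddMonoidHom.mem_ker, Isogeny.coe_toAddMonoidHom, ← coe_isogenyPrimaryMap (p := 2), hc, ZeroMemClass.coe_zero]
    obtain ⟨c', ⟨hc'C, -⟩, hc'⟩ := hcS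
    rwa [← Subtype.ext hc']
  -- the failing rational point of `E'`: a fixed `q ∈ C_v(E')` of order `2`
  obtain ⟨P, hP0, ⟨t, ht⟩, hE⟩ := hfail (C₁ • W₁) hiso
  set m' : (C₁ • W₁).geomPrimaryTorsion 2 := ⟨toGeomPoints (C₁ • W₁) P, (AddCommGroup.mem_primaryComponent).mpr ⟨t, ht⟩⟩ with hm'
  have hm'C : m' ∈ (reductionDatum (C₁ • W₁) 2 hv hΔ').plus := mem_plus_of_mem_localKernelOfReduction (C₁ • W₁) hv hΔ' P ht hE
  have hm'fix : ∀ τ : absoluteGaloisGroup ℚ, τ • m' = m' := smul_eq_self_of_toGeomPoints (C₁ • W₁) P ht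
  have hm'0 : m' ≠ 0 := fun h ↦ hP0 ((C₁ • W₁).toGeomPoints_injective
    (by rw [map_zero]; exact congrArg Subtype.val h))
  have ht' : 2 ^ t • m' = 0 := Subtype.ext (by rw [AddSubgroupClass.coe_nsmul, hm', ht, ZeroMemClass.coe_zero])
  obtain ⟨e, -, he⟩ := (Nat.dvd_prime_pow Nat.prime_two).mp (addOrderOf_dvd_of_nsmul_eq_zero ht')
  obtain ⟨e', rfl⟩ : ∃ e', e = e' + 1 := by
    rcases Nat.eq_zero_or_pos e with rfl | hpos
    · rw [pow_zero, AddMonoid.addOrderOf_eq_one_iff] at he; exact absurd he hm'0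
    · exact ⟨e - 1, by omega⟩
  set q : (C₁ • W₁).geomPrimaryTorsion 2 := 2 ^ e' • m' with hq
  have hq2 : 2 • q = 0 := by rw [hq, ← mul_nsmul, ← pow_succ, ← he]; exact addOrderOf_nsmul_eq_zero m'
  have hq0 : q ≠ 0 := by
    intro h
    have hdvd := addOrderOf_dvd_of_nsmul_eq_zero (hq ▸ h : 2 ^ e' • m' = 0)
    rw [he, Nat.pow_dvd_pow_iff_le_right'] at hdvd
    omega
  have hqC : q ∈ (reductionDatum (C₁ • W₁) 2 hv hΔ').plus := AddSubgroup.nsmul_mem _ hm'C _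
  have hqfix : ∀ τ : absoluteGaloisGroup ℚ, τ • q = q := fun τ ↦ by
    rw [hq, ← smul_comm (2 ^ e') τ m', hm'fix τ]
  -- `ψ m ∈ C_v(E') ∩ E'[2] = {0, q}` is fixed by `σ`
  set n' := isogenyPrimaryMap (p := 2) ψ m with hn'
  have hn'C : n' ∈ (reductionDatum (C₁ • W₁) 2 hv hΔ').plus := isogenyPrimaryMap_mem_plus hv hΔ hord hΔ' hord' ψ hmC
  have hn'2 : 2 • n' = 0 := by
    rw [hn', ← map_nsmul]
    have h2mS : ((2 • m : W.geomPrimaryTorsion 2) : W.geomPoints) ∈ S :=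
      ⟨2 • m, ⟨AddSubgroup.nsmul_mem _ hmC _, AddSubgroup.torsionBy.nsmul_iff.mpr (by rw [← mul_nsmul, ← pow_succ', hm])⟩, rfl⟩
    rw [← hkerψ, AddMonoidHom.mem_ker, Isogeny.coe_toAddMonoidHom, ← coe_isogenyPrimaryMap (p := 2)] at h2mS
    exact Subtype.ext h2mS
  have hσn' : σ • n' ∈ (reductionDatum (C₁ • W₁) 2 hv hΔ').plus := by
    rcases eq_zero_or_eq_of_mem_plus_two_nsmul (C₁ • W₁) hv hΔ' hord' hqC hq2 hq0 hn'C hn'2 with h | h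
    · rw [h, smul_zero]; exact AddSubgroup.zero_mem _
    · rw [h, hqfix σ]; exact hqC
  rw [hn', ← isogenyPrimaryMap_smul] at hσn'
  exact mem_plus_of_isogenyPrimaryMap_mem hv hΔ hord hΔ' hord' ψ hkerC hσn'

include hgo in
/-- **All layers are rational** under the failure hypothesis: by induction from the trivial layer `k = 0`.
[cite: SilvermanAEC2009, Prop. III.4.12] [cite: GreenbergLNM1716, §2 pp. 63, 69–70] -/
theorem smul_mem_plus_of_fails
    (hfail : ∀ (W' : WeierstrassCurve ℚ) [W'.IsElliptic] [W'.IsGloballyMinimal], IsIsogenous W W' →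
      ∃ P : W'.toAffine.Point, P ≠ 0 ∧ (∃ t : ℕ, 2 ^ t • toGeomPoints W' P = 0) ∧
        pointsMap W' (v.adicCompletion ℚ) (toGeomPoints W' P) ∈ W'.localKernelOfReduction v)
    (k : ℕ) (σ : absoluteGaloisGroup ℚ) (m : W.geomPrimaryTorsion 2)
    (hmC : m ∈ (reductionDatum W 2 hv (W.not_dvd_minimalDiscriminantInt_of_hasGoodReductionAtPrime' 2 hgo.1)).plus)
    (hm : 2 ^ k • m = 0) :
    σ • m ∈ (reductionDatum W 2 hv (W.not_dvd_minimalDiscriminantInt_of_hasGoodReductionAtPrime' 2 hgo.1)).plus := by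
  induction k generalizing σ m with
  | zero =>
    rw [pow_zero, one_nsmul] at hm
    rw [hm, smul_zero]; exact AddSubgroup.zero_mem _
  | succ k ih => exact smul_mem_plus_succ_of_fails hv hgo hfail k ih σ m hmC hm

end Step

/-! ## §8 The cyclic `32`-isogeny and Mazur–Kenku: (ISO-T₁) -/

section Main

open Summit.BirchSwinnertonDyer.BirchSwinnertonDyer.Theses.TwoAdicConverse (OrdLambdaHalfAtTwo GoodOrdinaryRankZeroTwoConverse)

/-- ★★ **(ISO-T₁)∣(β) FROM MAZUR–KENKU.**  For every NON-CM globally minimal `E/ℚ` with good ORDINARY reduction at `2` there are a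
globally minimal elliptic `E'` `ℚ`-ISOGENOUS to `E` and the place `v₂ ∋ 2` such that NO non-zero rational point of `E'` whose image in
`E'(ℚ̄)` is `2`-power torsion maps into the kernel of reduction `E'₁(ℚ̄₂)` — the displayed hypothesis `hISO` of p749231, per curve.
Input: Mazur–Kenku (`mazurKenku_exists_cyclic_isogeny`, Silverman IX.6 Ex. 6.4: isogenous curves over `ℚ` are joined by a CYCLIC
isogeny of degree in `{1,…,19,21,25,27,37,43,67,163}`).  Proof (road K): if every isogenous minimal curve failed, all layers
`C_v(E) ∩ E[2^k]` would be `Γ_ℚ`-stable (§7), so `E → E/(C_v ∩ E[32])` is a rational isogeny `g₅` with CYCLIC kernel of order `32`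
(§5); with Mazur–Kenku's cyclic `φ : E → E/(C_v ∩ E[32])` of degree `d` and its dual `φ̂` (`φ̂φ = [d]`), `φ̂ ∘ g₅ ∈ End(E) = ℤ`
(`¬ HasCM`) is `[n]` with `32 ∣ n` (the kernel contains a point of order `32`) and `n² = #ker[n] = #ker φ̂ · 32 = 32 d` (`g₅`, `φ` onto,
`#ker φ̂ · d = d²`), so `32 ∣ d` — not a Kenku degree.
[cite: SilvermanAEC2009, IX.6 Example 6.4; III.4.12; III.6.1–6.2; VII.2.1–2.2] [cite: Mazur1978, Thm. 1] [cite: Kenku1982]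
[cite: GreenbergLNM1716, §2 pp. 62–63, 69–70] -/
theorem exists_isIsogenous_T1_of_mazurKenku (hMK : mazurKenku_exists_cyclic_isogeny)
    (W : WeierstrassCurve ℚ) [W.IsElliptic] [W.IsGloballyMinimal] (hcm : ¬ W.HasCM) (hgo : Rank1Residual.GoodOrd W 2) :
    ∃ (W' : WeierstrassCurve ℚ) (_ : W'.IsElliptic) (_ : W'.IsGloballyMinimal) (v2 : HeightOneSpectrum (𝓞 ℚ)),
      ((2 : ℕ) : 𝓞 ℚ) ∈ v2.asIdeal ∧ IsIsogenous W W' ∧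
      ∀ P : W'.toAffine.Point, (∃ t : ℕ, 2 ^ t • toGeomPoints W' P = 0) →
        pointsMap W' (v2.adicCompletion ℚ) (toGeomPoints W' P) ∈ W'.localKernelOfReduction v2 → P = 0 := by
  obtain ⟨v, hv⟩ := exists_heightOneSpectrum_natCast_mem (K := ℚ) Nat.prime_two
  by_contra hcon
  have hfail : ∀ (W' : WeierstrassCurve ℚ) [W'.IsElliptic] [W'.IsGloballyMinimal], IsIsogenous W W' →
      ∃ P : W'.toAffine.Point, P ≠ 0 ∧ (∃ t : ℕ, 2 ^ t • toGeomPoints W' P = 0) ∧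
        pointsMap W' (v.adicCompletion ℚ) (toGeomPoints W' P) ∈ W'.localKernelOfReduction v := by
    intro W' _ _ hiso
    by_contra h
    push Not at h
    exact hcon ⟨W', inferInstance, inferInstance, v, hv, hiso, fun P ht hE ↦ by
      by_contra hP; exact h P hP ht hE⟩
  set hΔ := W.not_dvd_minimalDiscriminantInt_of_hasGoodReductionAtPrime' 2 hgo.1 with hΔdef
  have hord : ¬ (2 : ℤ) ∣ W.frobeniusTrace 2 := hgo.2
  -- the rational cyclic subgroup `S₅ = C_v ∩ E[32]` and the quotient `g₅ : E → E₅`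
  obtain ⟨g, hgC, hgord, hlayer⟩ := exists_layer_eq_zmultiples W hv hΔ hord 5
  set S : AddSubgroup W.geomPoints := ((reductionDatum W 2 hv hΔ).plus ⊓
    AddSubgroup.torsionBy (W.geomPrimaryTorsion 2) ((2 ^ 5 : ℕ) : ℤ)).map (W.geomPrimaryTorsion 2).subtype with hS
  have hSg : S = AddSubgroup.zmultiples (g : W.geomPoints) := by rw [hS, hlayer, AddMonoidHom.map_zmultiples]; rfl
  have hSfin : (S : Set W.geomPoints).Finite := (finite_layer_and_natCard W hv hΔ hord 5).1
  have hScard : Nat.card S = 2 ^ 5 := (finite_layer_and_natCard W hv hΔ hord 5).2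
  have hSstab : ∀ (τ : absoluteGaloisGroup ℚ) (P : W.geomPoints), P ∈ S → τ • P ∈ S := by
    rintro τ _ ⟨c, ⟨hcC, hck⟩, rfl⟩
    refine ⟨τ • c, ⟨smul_mem_plus_of_fails hv hgo hfail 5 τ c hcC (AddSubgroup.torsionBy.nsmul_iff.mp hck),
      AddSubgroup.torsionBy.nsmul_iff.mpr ?_⟩, (primaryComponent.coe_smul 2 τ c).symm⟩
    rw [smul_comm, AddSubgroup.torsionBy.nsmul_iff.mp hck, smul_zero]
  obtain ⟨W₅, hW₅, g₅, -, hker₅, -, -⟩ := W.exists_isogeny_ker_eq_and_comp_eq_nsmul_holds S hSfin hSstab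
  -- Mazur–Kenku's cyclic isogeny `φ : E → E₅` of degree `d ∈ kenkuDegrees`, and its dual
  obtain ⟨φ, -, hφd⟩ := hMK W W₅ ⟨g₅⟩
  obtain ⟨φd, hφdual⟩ := Isogeny.exists_dual_holds_of_isElliptic (W := W) (W' := W₅) φ
  set d := φ.degree with hd
  -- `φ̂ ∘ g₅ = [n]` (`End(E) = ℤ`)
  set η : Isogeny W W := φd.comp g₅ with hη
  obtain ⟨n, hn⟩ : ∃ n : ℤ, (η.toAddMonoidHom : AddMonoid.End W.geomPoints) = (n : AddMonoid.End W.geomPoints) := by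
    by_contra h
    push Not at h
    exact hcm ⟨_, W.endRing_le_geomEndRing (η.toAddMonoidHom_mem_endRing W), h⟩
  have hηP : ∀ P : W.geomPoints, φd (g₅ P) = n • P := fun P ↦ by
    rw [← Isogeny.comp_apply, ← hη, ← Isogeny.coe_toAddMonoidHom, ← AddMonoid.End.intCast_apply n P]
    exact AddMonoid.End.ext_iff.1 hn P
  -- `32 ∣ n`: the generator `g ∈ ker g₅` has order `32`
  have hgker : g₅ (g : W.geomPoints) = 0 := by
    have : (g : W.geomPoints) ∈ g₅.toAddMonoidHom.ker := by rw [hker₅, hSg]; exact AddSubgroup.mem_zmultiples _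
    exact this
  have hgord' : addOrderOf (g : W.geomPoints) = 2 ^ 5 := by
    have ho := addOrderOf_injective (W.geomPrimaryTorsion 2).subtype Subtype.coe_injective g
    rw [AddSubgroup.coe_subtype] at ho
    rw [ho, hgord]
  have h32n : (32 : ℤ) ∣ n := by
    have h := hηP (g : W.geomPoints)
    rw [hgker, map_zero] at h
    have hdvd := (addOrderOf_dvd_iff_zsmul_eq_zero).mpr h.symm
    rw [hgord'] at hdvd
    exact_mod_cast hdvd
  -- kernel counting: `#ker [n] = #ker φ̂ · 32` and `#ker φ̂ · d = d²`
  have hcount₁ : Nat.card η.toAddMonoidHom.ker = Nat.card φd.toAddMonoidHom.ker * 2 ^ 5 := by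
    rw [hη, Isogeny.ker_comp, natCard_comap_eq_of_surjective g₅.toAddMonoidHom g₅.surjective, hker₅, hScard, mul_comm]
  have hcount₂ : Nat.card (φd.comp φ).toAddMonoidHom.ker = Nat.card φd.toAddMonoidHom.ker * d := by
    rw [Isogeny.ker_comp, natCard_comap_eq_of_surjective φ.toAddMonoidHom φ.surjective, hd, Isogeny.degree, mul_comm]
  have hker_d : (φd.comp φ).toAddMonoidHom.ker = W.geomTorsion (d : ℤ) := by
    ext P
    rw [AddMonoidHom.mem_ker, Isogeny.coe_toAddMonoidHom, Isogeny.comp_apply, hφdual, W.mem_geomTorsion_iff]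
  have hker_n : η.toAddMonoidHom.ker = W.geomTorsion (n.natAbs : ℤ) := by
    ext P
    rw [AddMonoidHom.mem_ker, Isogeny.coe_toAddMonoidHom, hη, Isogeny.comp_apply, hηP, W.mem_geomTorsion_iff, natCast_zsmul,
      natAbs_nsmul_eq_zero]
  have hdpos : 0 < d := φ.degree_pos
  have hφd_card : Nat.card φd.toAddMonoidHom.ker = d := by
    have h := hcount₂
    rw [hker_d, natCard_geomTorsion_natCast W hdpos.ne', pow_two] at h
    exact (Nat.eq_of_mul_eq_mul_right hdpos h).symm
  -- `n ≠ 0`: `ker [n]` is finite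
  have hn0 : n.natAbs ≠ 0 := by
    intro h0
    have htop : η.toAddMonoidHom.ker = ⊤ := by
      rw [hker_n, h0]; ext P; simp [W.mem_geomTorsion_iff]
    have hfin : (η.toAddMonoidHom.ker : Set W.geomPoints).Finite := η.finite_ker
    rw [htop, AddSubgroup.coe_top] at hfin
    exact Set.infinite_univ (α := W.geomPoints) hfin
  have hsq : n.natAbs ^ 2 = d * 2 ^ 5 := by
    rw [← natCard_geomTorsion_natCast W hn0, ← hker_n, hcount₁, hφd_card]
  -- `32 ∣ n` and `n² = 32 d` force `32 ∣ d`, impossible for a Kenku degree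
  have h32 : 32 ∣ n.natAbs := by
    have := Int.natAbs_dvd_natAbs.mpr h32n
    simpa using this
  obtain ⟨c, hc⟩ := h32
  have h32d : 32 ∣ d := ⟨c ^ 2, by
    have : (32 * c) ^ 2 = d * 2 ^ 5 := by rw [← hc]; exact hsq
    nlinarith [this]⟩
  have hmem := mem_kenkuDegrees_iff.mp hφd
  simp only [Finset.mem_insert, Finset.mem_singleton] at hmem
  omega

/-- **ITEM 19218 FROM PRINT {modularity, Kato 17.4 (1)(2)@2, Mazur–Kenku} AND THE CRUX `OrdLambdaHalfAtTwo` — no Greenberg Thm. 4.1,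
no displayed (ISO-T₁).**  p749231's `goodOrdinaryRankZeroTwoConverse_of_ordLambdaHalfAtTwo_of_isoT1` with its class-level hypothesis
`hISO` DISCHARGED by `exists_isIsogenous_T1_of_mazurKenku` (the torsion-parity clause of `hISO` is not needed).  Item 19218 stays OPEN
(the crux is open); BSD is not proved by any of this. [cite: SilvermanAEC2009, IX.6 Example 6.4] [cite: Mazur1978, Thm. 1] [cite: Kenku1982]
[cite: Kato2004Asterisque, Thm. 17.4 (1)(2) (p. 273)] [cite: GreenbergLNM1716, Thm. 4.1 (p. 102)] -/
theorem goodOrdinaryRankZeroTwoConverse_of_ordLambdaHalfAtTwo_of_mazurKenku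
    (hmod : ModularForms.nonempty_modularParametrizationData)
    (h17 : ∀ (W : WeierstrassCurve ℚ) [W.IsElliptic] [W.IsGloballyMinimal]
      [NeZero (W.conductorNorm ℤ)] (f : CuspForm (CongruenceSubgroup.Gamma0 (W.conductorNorm ℤ)) 2),
      kato_divisibility_allPrimes W 2 (f := f))
    (hΛ : OrdLambdaHalfAtTwo) (hMK : mazurKenku_exists_cyclic_isogeny) :
    GoodOrdinaryRankZeroTwoConverse :=
  goodOrdinaryRankZeroTwoConverse_of_ordLambdaHalfAtTwo_of_isoT1 hmod h17 hΛ
    fun W _ _ hcm hgo _ ↦ exists_isIsogenous_T1_of_mazurKenku hMK W hcm hgo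

end Main

end Summit.BirchSwinnertonDyer.BirchSwinnertonDyer.Theorems.TwoAdicEulerCharKernel.IsoT1

end
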